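import Mathlib
import HarnessLib

/-!
# Forbes–Saptharishi–Shpilka 2014, §3.3: the shift (transfer) matrix is a good code
# (FSS14 Construction 19, Lemmas 20–24) — proofs, no statements

M. Forbes, R. Saptharishi, A. Shpilka, *Hitting sets for multilinear read-once algebraic branching
programs, in any order*, STOC 2014 = arXiv:1309.5668 [ForbesSaptharishiShpilka2014], §3.3
"Small-support rank concentration via rank condensers" (paper:arxiv-1309.5668 p0014–p0016). This is
the first of the proof files discharging FSV 2018 Lemma 40 (`FSV2018_lemma40` =
[FSS14, Thm. 28 / STOC Thm. 4.1], tree file `FSV18SuccinctGenerators.lean`); it contains the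
combinatorial core of [FSS14, §3.3], following the printed proof:

* **Construction 19** (the transfer matrix of the shift `f(x) ↦ f(x + t)`): the coefficient of
  `x^a` in `f(x + v)` is `∑_b binom(b, a) v^{b-a} coeff_b f` — `coeff_aeval_X_add_C` with the
  multi-binomial `mchoose b a = ∏_i binom(b_i, a_i)` (`T_{a,b} = binom(b,a) t^{b-a}`, p0014:L46).
* **Lemma 20** (fingerprints): among `r` distinct strings there is one distinguished from all the
  others by its restriction to a set of at most `⌊log₂ r⌋` coordinates — `exists_fingerprint`
  (p0015:L1–L8, the halving induction as printed).
* **Lemma 21** (univariate isolating operators; "`D` is upper triangular with `1`'s on the diagonal,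
  thus invertible", p0015:L12–L15): made explicit as binomial inversion
  `∑_k (-1)^{k+m} binom(k,m) binom(n,k) = [n = m]` — `binomial_inversion`.
* **Lemma 22** (a small-support combination of rows of `T(1)` isolating one string):
  `indicator_sum` — the combination with coefficients `signedChoose T β a` of the rows `a` supported
  in `T` evaluates on column `b` to `[b|_T = β|_T]` (p0015:L18–L30).
* **Lemma 24** ("`T_r(1)` is the parity check matrix of a distance `> r` code", p0016:L1–L6):
  `transferCode_eq_zero` — any `≤ 2^ℓ` distinct columns `b` (exponents of individual degree `≤ d`
  supported in `S`) of the matrix `(binom(b,a))_{a : |supp a| ≤ ℓ}` are linearly independent; proved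
  by induction on the number of columns with Lemmas 20–22 (Cor. 23's triangular system, inlined).

Everything here is characteristic-free (binomials, not factorials — the printed remark after
Lemma 21 on Hasse derivatives), over an arbitrary commutative ring where possible.
No definitions of mathematical content beyond the three bookkeeping abbreviations (`boxExps`,
`mchoose`, `signedChoose`); no named facts; nothing here bears on `VP ≠ VNP`.

## References
* [ForbesSaptharishiShpilka2014] arXiv:1309.5668, §3.3, Construction 19, Lemmas 20–24
  (locator: paper:arxiv-1309.5668 p0014.txt:L40 – p0016.txt:L10).
* [ForbesShpilkaVolk2018] M. Forbes, A. Shpilka, B. L. Volk, Theory Comput. 14 (2018) =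
  arXiv:1701.05328, Lemma 40 (seq.) = ToC Lemma 5.16 — the consumer.
-/

noncomputable section

open MvPolynomial Finset

open scoped BigOperators

namespace Literature.Computability.AlgebraicComplexity

namespace FSS2014

/-! ### Lemma 20: fingerprints -/

section Fingerprint

variable {ι V X : Type*} [DecidableEq ι] [DecidableEq V] [DecidableEq X]

/-- **[FSS14, Lemma 20] (fingerprints).** "Let `b_1, …, b_r ∈ Σ^n` be distinct strings. Then there
is an `i₀ ∈ [r]` and `S ⊆ [n]` with `|S| ≤ ⌊log₂ r⌋` such that `(b_{i₀})|_S ≠ (b_i)|_S` for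
`i ≠ i₀`." Strings are elements of `X` read through coordinates `proj : X → ι → V`; "distinct" =
separated by the coordinates in `S`. Proof as printed: split on a coordinate where not all strings
agree, recurse into the least frequent fibre (of size `≤ r/2`).
[cite: ForbesSaptharishiShpilka2014, Lemma 20] locator: paper:arxiv-1309.5668 p0015.txt:L1–L8 -/
theorem exists_fingerprint (proj : X → ι → V) (S : Finset ι) (B : Finset X) (hB : B.Nonempty)
    (hsep : ∀ b ∈ B, ∀ b' ∈ B, (∀ j ∈ S, proj b j = proj b' j) → b = b') :
    ∃ b₀ ∈ B, ∃ T ⊆ S, T.card ≤ Nat.log 2 B.card ∧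
      ∀ b ∈ B, b ≠ b₀ → ∃ j ∈ T, proj b j ≠ proj b₀ j := by
  induction hn : B.card using Nat.strong_induction_on generalizing B with
  | _ n ih =>
    by_cases hone : ∀ b ∈ B, ∀ b' ∈ B, b = b'
    · obtain ⟨b₀, hb₀⟩ := hB
      exact ⟨b₀, hb₀, ∅, empty_subset _, by simp, fun b hb hne => (hne (hone b hb b₀ hb₀)).elim⟩
    push Not at hone
    obtain ⟨b₁, hb₁, b₂, hb₂, hne⟩ := hone
    -- a coordinate `j ∈ S` where `b₁, b₂` differ
    have hj : ∃ j ∈ S, proj b₁ j ≠ proj b₂ j := by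
      by_contra hcon
      push Not at hcon
      exact hne (hsep b₁ hb₁ b₂ hb₂ hcon)
    obtain ⟨j, hjS, hj12⟩ := hj
    -- the fibres of the `j`-th coordinate
    set vals : Finset V := B.image fun b => proj b j with hvals
    set fib : V → Finset X := fun v => B.filter fun b => proj b j = v with hfib
    have hvals_ne : vals.Nonempty := ⟨proj b₁ j, mem_image_of_mem _ hb₁⟩
    obtain ⟨σ, hσ, hσmin⟩ := exists_min_image vals (fun v => (fib v).card) hvals_ne
    have hsum : B.card = ∑ v ∈ vals, (fib v).card := card_eq_sum_card_image _ _
    have hvcard : 2 ≤ vals.card := by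
      have h1 : proj b₁ j ∈ vals := mem_image_of_mem _ hb₁
      have h2 : proj b₂ j ∈ vals := mem_image_of_mem _ hb₂
      have : ({proj b₁ j, proj b₂ j} : Finset V) ⊆ vals := by
        intro v hv
        simp only [mem_insert, mem_singleton] at hv
        rcases hv with rfl | rfl <;> assumption
      calc 2 = ({proj b₁ j, proj b₂ j} : Finset V).card := (card_pair hj12).symm
        _ ≤ vals.card := card_le_card this
    -- the least frequent value occurs at most `n / 2` times
    have hfibσ : 2 * (fib σ).card ≤ n := by
      have h1 : vals.card • (fib σ).card ≤ ∑ v ∈ vals, (fib v).card :=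
        card_nsmul_le_sum _ _ _ fun v hv => hσmin v hv
      rw [smul_eq_mul] at h1
      calc 2 * (fib σ).card ≤ vals.card * (fib σ).card := Nat.mul_le_mul_right _ hvcard
        _ ≤ _ := h1
        _ = n := by rw [← hsum, hn]
    have hσne : (fib σ).Nonempty := by
      obtain ⟨b, hb, hbσ⟩ := mem_image.1 hσ
      exact ⟨b, mem_filter.2 ⟨hb, hbσ⟩⟩
    have hσpos : 0 < (fib σ).card := card_pos.2 hσne
    have hlt : (fib σ).card < n := by omega
    have hsub : fib σ ⊆ B := filter_subset _ _
    obtain ⟨b₀, hb₀, T', hT'S, hT'card, hT'sep⟩ := ih _ hlt (fib σ) hσne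
      (fun b hb b' hb' h => hsep b (hsub hb) b' (hsub hb') h) rfl
    refine ⟨b₀, hsub hb₀, insert j T', insert_subset hjS hT'S, ?_, ?_⟩
    · -- `|T| ≤ |T'| + 1 ≤ log₂ (n/2) + 1 = log₂ n`
      have h2n : 2 ≤ n := by omega
      have hlogpos : 0 < Nat.log 2 n := Nat.log_pos one_lt_two h2n
      have hle : (fib σ).card ≤ n / 2 := by omega
      have hlog : Nat.log 2 (fib σ).card ≤ Nat.log 2 n - 1 := by
        rw [← Nat.log_div_base]
        exact Nat.log_mono_right hle
      calc (insert j T').card ≤ T'.card + 1 := card_insert_le _ _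
        _ ≤ Nat.log 2 (fib σ).card + 1 := by omega
        _ ≤ Nat.log 2 n := by omega
    · intro b hb hbne
      by_cases hbj : proj b j = σ
      · have hbfib : b ∈ fib σ := mem_filter.2 ⟨hb, hbj⟩
        obtain ⟨j', hj', hne'⟩ := hT'sep b hbfib hbne
        exact ⟨j', mem_insert_of_mem hj', hne'⟩
      · have hb₀j : proj b₀ j = σ := (mem_filter.1 hb₀).2
        exact ⟨j, mem_insert_self _ _, by rw [hb₀j]; exact hbj⟩

end Fingerprint

/-! ### Lemma 21: binomial inversion (the inverse of the unitriangular matrix `binom(n,k)`) -/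

/-- **[FSS14, Lemma 21], explicit form.** The matrix `D_{k,n} = binom(n,k)` (`k, n ≤ d`) is upper
unitriangular, hence invertible ("if we used normal (non-Hasse) derivatives then the diagonal of
`D` would not have `1`'s, and `D` would not be invertible in sufficiently small characteristic");
its inverse is `binom(k,m) (-1)^{k+m}`: for `n ≤ N`,
`∑_{k ≤ N} (-1)^{k+m} binom(k,m) binom(n,k) = [n = m]`.
[cite: ForbesSaptharishiShpilka2014, Lemma 21] locator: paper:arxiv-1309.5668 p0015.txt:L12–L15 -/
theorem binomial_inversion (n m N : ℕ) (hn : n ≤ N) :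
    ∑ k ∈ range (N + 1), ((-1 : ℤ) ^ (k + m) * (k.choose m : ℤ) * (n.choose k : ℤ)) =
      if n = m then 1 else 0 := by
  by_cases hmn : m ≤ n
  · -- restrict the sum to `m ≤ k ≤ n`
    have hvan : ∀ k ∈ range (N + 1), k ∉ Ico m (n + 1) →
        ((-1 : ℤ) ^ (k + m) * (k.choose m : ℤ) * (n.choose k : ℤ)) = 0 := by
      intro k _ hk
      rw [mem_Ico, not_and_or, not_le, not_lt] at hk
      rcases hk with hk | hk
      · rw [Nat.choose_eq_zero_of_lt hk]; simp
      · rw [Nat.choose_eq_zero_of_lt (by omega : n < k)]; simp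
    have hsub : Ico m (n + 1) ⊆ range (N + 1) := by
      intro k hk
      rw [mem_Ico] at hk
      exact mem_range.2 (by omega)
    have key : ∀ k ∈ range (n + 1 - m),
        ((-1 : ℤ) ^ (m + k + m) * ((m + k).choose m : ℤ) * (n.choose (m + k) : ℤ)) =
          (n.choose m : ℤ) * ((-1 : ℤ) ^ k * ((n - m).choose k : ℤ)) := by
      intro k _
      have h := Nat.choose_mul (n := n) (k := m + k) (s := m) (Nat.le_add_right m k)
      rw [Nat.add_sub_cancel_left] at h
      have h' : ((m + k).choose m : ℤ) * (n.choose (m + k) : ℤ) =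
          (n.choose m : ℤ) * ((n - m).choose k : ℤ) := by
        rw [mul_comm]; exact_mod_cast h
      have hsign : ((-1 : ℤ) ^ (m + k + m)) = (-1) ^ k := by
        rw [show m + k + m = k + 2 * m by ring, pow_add, pow_mul]; simp
      rw [hsign, mul_assoc, h']; ring
    calc ∑ k ∈ range (N + 1), ((-1 : ℤ) ^ (k + m) * (k.choose m : ℤ) * (n.choose k : ℤ))
        = ∑ k ∈ Ico m (n + 1), ((-1 : ℤ) ^ (k + m) * (k.choose m : ℤ) * (n.choose k : ℤ)) :=
          (sum_subset hsub hvan).symm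
      _ = ∑ k ∈ range (n + 1 - m),
            ((-1 : ℤ) ^ (m + k + m) * ((m + k).choose m : ℤ) * (n.choose (m + k) : ℤ)) :=
          sum_Ico_eq_sum_range _ _ _
      _ = ∑ k ∈ range (n + 1 - m), (n.choose m : ℤ) * ((-1 : ℤ) ^ k * ((n - m).choose k : ℤ)) :=
          sum_congr rfl key
      _ = (n.choose m : ℤ) * ∑ k ∈ range (n - m + 1), ((-1 : ℤ) ^ k * ((n - m).choose k : ℤ)) := by
          rw [← mul_sum, show n + 1 - m = n - m + 1 by omega]
      _ = if n = m then 1 else 0 := by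
          rw [Int.alternating_sum_range_choose]
          by_cases hnm : n = m
          · subst hnm; simp
          · have : n - m ≠ 0 := by omega
            simp [this, hnm]
  · push Not at hmn
    have : (if n = m then (1 : ℤ) else 0) = 0 := if_neg (by omega)
    rw [this]
    refine sum_eq_zero fun k _ => ?_
    rcases lt_or_ge k m with hk | hk
    · rw [Nat.choose_eq_zero_of_lt hk]; simp
    · rw [Nat.choose_eq_zero_of_lt (by omega : n < k)]; simp

/-! ### Construction 19: exponents in a box and the multi-binomial `binom(b,a) = ∏ binom(bᵢ,aᵢ)` -/

section Box

variable {ι : Type*}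

/-- The exponents of "individual degree `≤ d`" polynomials in the variables `S`: finitely supported
`a : ι →₀ ℕ` with `supp a ⊆ S` and `a i ≤ d` (the row/column index set of the transfer matrix
`T(t)` of Construction 19, there "individual degree `< d`"). [cite: ForbesSaptharishiShpilka2014, Construction 19]
locator: paper:arxiv-1309.5668 p0014.txt:L44–L48 -/
def boxExps [DecidableEq ι] (S : Finset ι) (d : ℕ) : Finset (ι →₀ ℕ) :=
  S.finsupp fun _ => range (d + 1)

/-- Membership in the box of exponents: support in `S`, entries `≤ d`.
[cite: ForbesSaptharishiShpilka2014, Construction 19] locator: paper:arxiv-1309.5668 p0014.txt:L44–L48 -/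
theorem mem_boxExps [DecidableEq ι] {S : Finset ι} {d : ℕ} {a : ι →₀ ℕ} :
    a ∈ boxExps S d ↔ a.support ⊆ S ∧ ∀ i, a i ≤ d := by
  rw [boxExps, mem_finsupp_iff]
  refine ⟨fun ⟨h1, h2⟩ => ⟨h1, fun i => ?_⟩, fun ⟨h1, h2⟩ => ⟨h1, fun i _ => mem_range.2 ?_⟩⟩
  · by_cases hi : i ∈ S
    · exact Nat.lt_succ_iff.1 (mem_range.1 (h2 i hi))
    · have : a i = 0 := Finsupp.notMem_support_iff.1 fun h => hi (h1 h)
      omega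
  · exact Nat.lt_succ_of_le (h2 i)

/-- The box of exponents is monotone in the variable set. [cite: ForbesSaptharishiShpilka2014, Construction 19] locator: paper:arxiv-1309.5668 p0014.txt:L44–L48 -/
theorem boxExps_mono [DecidableEq ι] {S T : Finset ι} (h : T ⊆ S) (d : ℕ) :
    boxExps T d ⊆ boxExps S d := fun a ha => by
  rw [mem_boxExps] at ha ⊢
  exact ⟨ha.1.trans h, ha.2⟩

/-- The multi-binomial coefficient `binom(b, a) = ∏ᵢ binom(bᵢ, aᵢ)` — the entry `T_{a,b}(1)` of the
transfer matrix at `t = 1` (`T_{a,b}(t) = binom(b,a) t^{b-a}`), the coefficient of `x^a` in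
`(x + 1)^b`. The product is taken over the union of the supports (factors outside are `binom(0,0) = 1`).
[cite: ForbesSaptharishiShpilka2014, Construction 19] locator: paper:arxiv-1309.5668 p0014.txt:L44–L46 -/
def mchoose [DecidableEq ι] (b a : ι →₀ ℕ) : ℕ :=
  ∏ i ∈ a.support ∪ b.support, (b i).choose (a i)

/-- `binom(b,a)` as a product over any set of variables containing both supports.
[cite: ForbesSaptharishiShpilka2014, Construction 19] locator: paper:arxiv-1309.5668 p0014.txt:L44–L48 -/
theorem mchoose_eq_prod [DecidableEq ι] {b a : ι →₀ ℕ} {S : Finset ι}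
    (ha : a.support ⊆ S) (hb : b.support ⊆ S) :
    mchoose b a = ∏ i ∈ S, (b i).choose (a i) := by
  rw [mchoose]
  refine prod_subset (union_subset ha hb) fun i _ hi => ?_
  rw [mem_union, not_or, Finsupp.notMem_support_iff, Finsupp.notMem_support_iff] at hi
  rw [hi.1, hi.2, Nat.choose_zero_right]

/-- `binom(b,a)` as a product over all variables of a finite type. [cite: ForbesSaptharishiShpilka2014, Construction 19] locator: paper:arxiv-1309.5668 p0014.txt:L44–L48 -/
theorem mchoose_eq_prod_univ [DecidableEq ι] [Fintype ι] (b a : ι →₀ ℕ) :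
    mchoose b a = ∏ i, (b i).choose (a i) :=
  mchoose_eq_prod (subset_univ _) (subset_univ _)

/-- `binom(b,a) = 0` unless `a ≤ b` (the transfer matrix is triangular). [cite: ForbesSaptharishiShpilka2014, Construction 19] locator: paper:arxiv-1309.5668 p0014.txt:L44–L48 -/
theorem mchoose_eq_zero_of_not_le [DecidableEq ι] {b a : ι →₀ ℕ} (h : ¬ a ≤ b) : mchoose b a = 0 := by
  rw [Finsupp.le_def] at h
  push Not at h
  obtain ⟨i, hi⟩ := h
  have hia : i ∈ a.support := Finsupp.mem_support_iff.2 (by omega)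
  exact prod_eq_zero (mem_union_left _ hia) (Nat.choose_eq_zero_of_lt hi)

end Box

/-! ### Lemma 22: the isolating row combination -/

section Indicator

variable {ι : Type*} [DecidableEq ι]

/-- The coefficients of Lemma 22's operator `Δ = ∏_{j ∈ T} Δ_j`: on the row `a` (supported in `T`)
the product of the Lemma-21 inverse entries `(-1)^{a_j + β_j} binom(a_j, β_j)`.
[cite: ForbesSaptharishiShpilka2014, Lemma 22] locator: paper:arxiv-1309.5668 p0015.txt:L18–L30 -/
def signedChoose (T : Finset ι) (β a : ι →₀ ℕ) : ℤ :=
  ∏ j ∈ T, ((-1 : ℤ) ^ (a j + β j) * ((a j).choose (β j) : ℤ))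

/-- Sums over `boxExps T d` of products over `T` factor ("`∂_x^a ∂_y^b = ∂_{x^a y^b}` for disjoint
variables `x, y`", the composition step of Lemma 22).
[cite: ForbesSaptharishiShpilka2014, Lemma 22 (proof)] locator: paper:arxiv-1309.5668 p0015.txt:L22–L30 -/
theorem sum_boxExps_prod {R : Type*} [CommSemiring R] (T : Finset ι) (d : ℕ) (φ : ι → ℕ → R) :
    ∑ a ∈ boxExps T d, ∏ j ∈ T, φ j (a j) = ∏ j ∈ T, ∑ k ∈ range (d + 1), φ j k := by
  classical
  rw [prod_sum, boxExps, Finset.finsupp, sum_map]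
  refine sum_congr (by convert rfl) fun p hp => ?_
  rw [← prod_attach T]
  refine prod_congr rfl fun j _ => ?_
  simp only [Function.Embedding.coeFn_mk]
  rw [Finsupp.indicator_of_mem j.2]

/-- **[FSS14, Lemma 22] (isolating a string by a small-support row combination).** For a column
`b` of individual degree `≤ d`, the `signedChoose T β`-combination of the rows `a ∈ boxExps T d`
of the binomial matrix takes the value `[b|_T = β|_T]`: "`Δ(x^{b_i})(1) = 1[i = i₀]`".
[cite: ForbesSaptharishiShpilka2014, Lemma 22] locator: paper:arxiv-1309.5668 p0015.txt:L18–L30 -/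
theorem indicator_sum (T : Finset ι) (d : ℕ) (β b : ι →₀ ℕ) (hb : ∀ i, b i ≤ d) :
    ∑ a ∈ boxExps T d, signedChoose T β a * (mchoose b a : ℤ) =
      if ∀ j ∈ T, b j = β j then 1 else 0 := by
  have hrow : ∀ a ∈ boxExps T d, signedChoose T β a * (mchoose b a : ℤ) =
      ∏ j ∈ T, ((-1 : ℤ) ^ (a j + β j) * ((a j).choose (β j) : ℤ) * ((b j).choose (a j) : ℤ)) := by
    intro a ha
    rw [mem_boxExps] at ha
    rw [mchoose_eq_prod (S := T ∪ b.support) (ha.1.trans subset_union_left) subset_union_right,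
      ← prod_sdiff (subset_union_left : T ⊆ T ∪ b.support)]
    have h1 : ∏ i ∈ (T ∪ b.support) \ T, (b i).choose (a i) = 1 := by
      refine prod_eq_one fun i hi => ?_
      rw [mem_sdiff] at hi
      have : a i = 0 := Finsupp.notMem_support_iff.1 fun h => hi.2 (ha.1 h)
      rw [this, Nat.choose_zero_right]
    rw [h1, one_mul, signedChoose, Nat.cast_prod, ← prod_mul_distrib]
  rw [sum_congr rfl hrow, sum_boxExps_prod T d
    (fun j k => ((-1 : ℤ) ^ (k + β j) * (k.choose (β j) : ℤ) * ((b j).choose k : ℤ)))]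
  simp_rw [binomial_inversion (b _) (β _) d (hb _)]
  exact prod_boole

end Indicator

/-! ### Lemma 24: the small-support binomial matrix is a good code -/

section Code

variable {ι : Type*} [DecidableEq ι] {R : Type*} [CommRing R]

/-- **[FSS14, Lemma 24] (with Lemmas 20–22 and Cor. 23): "`T_r(1)` is the parity check matrix of a
distance `> r` code. That is, every `r` columns are linearly independent."** In the tree's
indexing: for at most `2^ℓ` distinct exponents `b ∈ B` of individual degree `≤ d` supported in `S`,
a vanishing `R`-combination `∑_{b ∈ B} μ_b binom(b, a) = 0` of the columns, tested against every row
`a` of support size `≤ ℓ` (and individual degree `≤ d`, support in `S`), is trivial. Proof as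
printed: a fingerprint `(b₀, T)` with `|T| ≤ log₂ |B| ≤ ℓ` (Lemma 20) and the isolating combination
of the rows supported in `T` (Lemma 22) give `μ_{b₀} = 0`; induct (Cor. 23).
[cite: ForbesSaptharishiShpilka2014, Lemma 24] locator: paper:arxiv-1309.5668 p0016.txt:L1–L6 -/
theorem transferCode_eq_zero (S : Finset ι) (d ℓ : ℕ) (B : Finset (ι →₀ ℕ))
    (hB : ∀ b ∈ B, b.support ⊆ S ∧ ∀ i, b i ≤ d) (hcard : B.card ≤ 2 ^ ℓ) (μ : (ι →₀ ℕ) → R)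
    (hrel : ∀ a ∈ boxExps S d, a.support.card ≤ ℓ → ∑ b ∈ B, μ b * (mchoose b a : R) = 0) :
    ∀ b ∈ B, μ b = 0 := by
  induction hn : B.card using Nat.strong_induction_on generalizing B with
  | _ n ih =>
    rcases B.eq_empty_or_nonempty with rfl | hne
    · simp
    -- Lemma 20: a fingerprint `(b₀, T)`
    obtain ⟨b₀, hb₀, T, hTS, hTcard, hsepT⟩ := exists_fingerprint (fun b : ι →₀ ℕ => (b : ι → ℕ))
      S B hne (fun b hb b' hb' h => by
        ext j
        by_cases hj : j ∈ S
        · exact h j hj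
        · rw [Finsupp.notMem_support_iff.1 fun hh => hj ((hB b hb).1 hh),
            Finsupp.notMem_support_iff.1 fun hh => hj ((hB b' hb').1 hh)])
    have hTℓ : T.card ≤ ℓ := by
      refine hTcard.trans ?_
      rcases Nat.eq_zero_or_pos B.card with h0 | hpos
      · simp [h0]
      · exact Nat.le_of_lt_succ ((Nat.log_lt_iff_lt_pow one_lt_two hpos.ne').2
          (lt_of_le_of_lt hcard (Nat.pow_lt_pow_right one_lt_two (Nat.lt_succ_self ℓ))))
    -- Lemma 22: test the relation against the isolating combination ⇒ `μ b₀ = 0`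
    have hμ₀ : μ b₀ = 0 := by
      have h1 : ∑ a ∈ boxExps T d, (signedChoose T b₀ a : R) *
          (∑ b ∈ B, μ b * (mchoose b a : R)) = 0 := by
        refine sum_eq_zero fun a ha => ?_
        have ha' := mem_boxExps.1 ha
        rw [hrel a (boxExps_mono hTS d ha) ((card_le_card ha'.1).trans hTℓ), mul_zero]
      have h2 : ∑ a ∈ boxExps T d, (signedChoose T b₀ a : R) *
          (∑ b ∈ B, μ b * (mchoose b a : R)) =
          ∑ b ∈ B, μ b * ((∑ a ∈ boxExps T d, signedChoose T b₀ a * (mchoose b a : ℤ) : ℤ) : R) := by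
        simp_rw [mul_sum, Int.cast_sum, mul_sum, Int.cast_mul, Int.cast_natCast]
        rw [sum_comm]
        refine sum_congr rfl fun b _ => sum_congr rfl fun a _ => by ring
      rw [h2] at h1
      rw [← h1, eq_comm]
      refine (sum_eq_single b₀ (fun b hb hne => ?_) (fun h => (h hb₀).elim)).trans ?_
      · rw [indicator_sum T d b₀ b (hB b hb).2, if_neg, Int.cast_zero, mul_zero]
        intro hall
        obtain ⟨j, hj, hne'⟩ := hsepT b hb hne
        exact hne' (hall j hj)
      · rw [indicator_sum T d b₀ b₀ (hB b₀ hb₀).2, if_pos fun j _ => rfl, Int.cast_one, mul_one]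
    -- Cor. 23: remove `b₀` and induct
    intro b hb
    by_cases hbb : b = b₀
    · rw [hbb, hμ₀]
    have hlt : (B.erase b₀).card < n := by
      have := card_pos.2 hne
      rw [card_erase_of_mem hb₀]; omega
    refine ih _ hlt (B.erase b₀) (fun b' hb' => hB b' (mem_of_mem_erase hb'))
      ((card_le_card (erase_subset _ _)).trans hcard) (fun a ha hal => ?_) rfl b (mem_erase.2 ⟨hbb, hb⟩)
    rw [← hrel a ha hal, ← add_sum_erase B _ hb₀, hμ₀, zero_mul, zero_add]

end Code

/-! ### Construction 19: the coefficients of the shifted polynomial `f(x + v)` -/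

section Shift

variable {ι K : Type*} [CommSemiring K] [DecidableEq ι]

omit [DecidableEq ι] in
/-- Expansion of the univariate factor `(xᵢ + c)^n = ∑_k binom(n,k) c^{n-k} xᵢ^k` in monomials
(the univariate transfer matrix, §3.1 / Construction 19). [cite: ForbesSaptharishiShpilka2014, Construction 19] locator: paper:arxiv-1309.5668 p0014.txt:L44–L48 -/
theorem X_add_C_pow_eq_sum (i : ι) (c : K) (n : ℕ) :
    ((X i + C c) ^ n : MvPolynomial ι K) =
      ∑ k ∈ range (n + 1), monomial (Finsupp.single i k) ((n.choose k : K) * c ^ (n - k)) := by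
  rw [add_pow]
  refine sum_congr rfl fun k _ => ?_
  rw [← map_natCast (C : K →+* MvPolynomial ι K), ← C_pow, mul_assoc, ← C_mul, mul_comm,
    C_mul_X_pow_eq_monomial, mul_comm]

/-- The coefficient of `xᵢ^k` in `(xᵢ + c)^n` is `binom(n,k) c^{n-k}` (the Hasse derivative
`∂_x^k(x^n)(c)`, Construction 19: "`T_{a,b} = binom(b,a) t^{b-a} = ∂_x^a(x^b)(t)`"). [cite: ForbesSaptharishiShpilka2014, Construction 19] locator: paper:arxiv-1309.5668 p0014.txt:L44–L48 -/
theorem coeff_single_X_add_C_pow (i : ι) (c : K) (n k : ℕ) :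
    coeff (Finsupp.single i k) ((X i + C c) ^ n : MvPolynomial ι K) = (n.choose k : K) * c ^ (n - k) := by
  rw [X_add_C_pow_eq_sum, coeff_sum]
  simp_rw [coeff_monomial, (Finsupp.single_injective i).eq_iff]
  rw [sum_ite_eq']
  split_ifs with h
  · rfl
  · rw [mem_range, not_lt] at h
    rw [Nat.choose_eq_zero_of_lt (by omega), Nat.cast_zero, zero_mul]

/-- The monomials of `(xᵢ + c)^n` are powers of `xᵢ`. [cite: ForbesSaptharishiShpilka2014, Construction 19] locator: paper:arxiv-1309.5668 p0014.txt:L44–L48 -/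
theorem support_X_add_C_pow (i : ι) (c : K) (n : ℕ) :
    ∀ m ∈ ((X i + C c) ^ n : MvPolynomial ι K).support, ∃ k, m = Finsupp.single i k := by
  intro m hm
  rw [X_add_C_pow_eq_sum] at hm
  obtain ⟨k, -, hk⟩ := mem_biUnion.1 (support_sum hm)
  exact ⟨k, mem_singleton.1 (support_monomial_subset hk)⟩

/-- Coefficients of a product of polynomials in distinct single variables: the coefficient of
`x^a` in `∏_{i ∈ s} Pᵢ(xᵢ)` is `∏_{i ∈ s} coeff_{aᵢ}(Pᵢ)` when `supp a ⊆ s`, and `0` otherwise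
("`∂_x^a ∂_y^b = ∂_{x^a y^b}` for disjoint variables `x, y`", Lemma 22's proof; used for the
shift `∏ᵢ (xᵢ + vᵢ)^{bᵢ}` of Construction 19). [cite: ForbesSaptharishiShpilka2014, Construction 19] locator: paper:arxiv-1309.5668 p0014.txt:L44–L48 -/
theorem coeff_prod_univariate (s : Finset ι) (P : ι → MvPolynomial ι K)
    (hP : ∀ i ∈ s, ∀ m ∈ (P i).support, ∃ k, m = Finsupp.single i k) (a : ι →₀ ℕ) :
    coeff a (∏ i ∈ s, P i) =
      if a.support ⊆ s then ∏ i ∈ s, coeff (Finsupp.single i (a i)) (P i) else 0 := by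
  induction s using Finset.induction_on generalizing a with
  | empty =>
    rw [prod_empty, prod_empty, coeff_one]
    by_cases h : a = 0
    · subst h; simp
    · rw [if_neg (Ne.symm h), if_neg]
      rwa [subset_empty, Finsupp.support_eq_empty]
  | insert j s hj ih =>
    have hPj := hP j (mem_insert_self j s)
    have hPs : ∀ i ∈ s, ∀ m ∈ (P i).support, ∃ k, m = Finsupp.single i k :=
      fun i hi => hP i (mem_insert_of_mem hi)
    rw [prod_insert hj, prod_insert hj, coeff_mul]
    -- only the splitting `a = single j (a j) + a.erase j` contributes
    have hmem : (Finsupp.single j (a j), a.erase j) ∈ antidiagonal a := by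
      rw [HasAntidiagonal.mem_antidiagonal, Finsupp.single_add_erase]
    rw [sum_eq_single (Finsupp.single j (a j), a.erase j) ?_ (fun h => (h hmem).elim)]
    · dsimp only
      rw [ih hPs (a.erase j), Finsupp.support_erase]
      by_cases h : a.support ⊆ insert j s
      · rw [if_pos (subset_insert_iff.1 h), if_pos h]
        congr 1
        exact prod_congr rfl fun i hi => by rw [Finsupp.erase_ne (ne_of_mem_of_not_mem hi hj)]
      · rw [if_neg (fun h' => h (subset_insert_iff.2 h')), if_neg h, mul_zero]
    · rintro ⟨x₁, x₂⟩ hx hne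
      rw [HasAntidiagonal.mem_antidiagonal] at hx
      dsimp only at hx ⊢
      by_contra hprod
      have h₁ : coeff x₁ (P j) ≠ 0 := fun h => hprod (by rw [h, zero_mul])
      have h₂ : coeff x₂ (∏ i ∈ s, P i) ≠ 0 := fun h => hprod (by rw [h, mul_zero])
      obtain ⟨k, rfl⟩ := hPj x₁ (mem_support_iff.2 h₁)
      have hx₂ : x₂.support ⊆ s := by
        by_contra hns
        rw [ih hPs x₂, if_neg hns] at h₂
        exact h₂ rfl
      have hx₂j : x₂ j = 0 := Finsupp.notMem_support_iff.1 fun h => hj (hx₂ h)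
      have hk : k = a j := by
        have := congrArg (fun f : ι →₀ ℕ => f j) hx
        simpa [Finsupp.add_apply, hx₂j] using this
      subst hk
      apply hne
      refine Prod.ext rfl ?_
      dsimp only
      ext i
      by_cases hij : i = j
      · subst hij
        rw [Finsupp.erase_same, hx₂j]
      · have := congrArg (fun f : ι →₀ ℕ => f i) hx
        simp only [Finsupp.add_apply, Finsupp.single_apply, if_neg (Ne.symm hij), zero_add] at this
        rw [Finsupp.erase_ne hij, this]

variable [Fintype ι]

/-- The transfer-matrix entry `T_{a,b}(v) = binom(b,a) v^{b-a} = ∏ᵢ binom(bᵢ,aᵢ) vᵢ^{bᵢ-aᵢ}`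
(Construction 19: "`T_{a,b} = binom(b,a) t^{b-a} = ∂_x^a(x^b)(t)`").
[cite: ForbesSaptharishiShpilka2014, Construction 19] locator: paper:arxiv-1309.5668 p0014.txt:L44–L46 -/
def shiftWt (v : ι → K) (a b : ι →₀ ℕ) : K :=
  ∏ i, ((b i).choose (a i) : K) * v i ^ (b i - a i)

/-- **[FSS14, Construction 19 / eq. (transfer)]:** "the coefficient of `x^a` in `f(x + t)` equals
`∑_b coeff_{x^b}(f) binom(b,a) t^{b-a}`", i.e. the coefficient vector of the shift is the transfer
matrix applied to the coefficient vector.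
[cite: ForbesSaptharishiShpilka2014, Construction 19] locator: paper:arxiv-1309.5668 p0014.txt:L40–L46 -/
theorem coeff_aeval_X_add_C (v : ι → K) (f : MvPolynomial ι K) (a : ι →₀ ℕ) :
    coeff a (aeval (fun i => X i + C (v i)) f) = ∑ b ∈ f.support, coeff b f * shiftWt v a b := by
  conv_lhs => rw [f.as_sum]
  rw [map_sum, coeff_sum]
  refine sum_congr rfl fun b _ => ?_
  rw [aeval_monomial, algebraMap_eq, coeff_C_mul,
    Finsupp.prod_fintype _ _ (fun i => pow_zero _),
    coeff_prod_univariate univ _ (fun i _ => support_X_add_C_pow i (v i) (b i)) a,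
    if_pos (subset_univ _), shiftWt]
  simp_rw [coeff_single_X_add_C_pow]

/-- `T_{a,b}(v) = binom(b,a) · ∏ᵢ vᵢ^{bᵢ - aᵢ}` with the multi-binomial `mchoose`. [cite: ForbesSaptharishiShpilka2014, Construction 19] locator: paper:arxiv-1309.5668 p0014.txt:L44–L48 -/
theorem shiftWt_eq (v : ι → K) (a b : ι →₀ ℕ) :
    shiftWt v a b = (mchoose b a : K) * ∏ i, v i ^ (b i - a i) := by
  rw [shiftWt, prod_mul_distrib, mchoose_eq_prod_univ, Nat.cast_prod]

/-- The factorisation `T(v) = Λ(v)⁻¹ · T(1) · W(v)` of [FSS14, Cor. 26] without division: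
`v^a · T_{a,b}(v) = binom(b,a) · v^b` (both sides vanish unless `a ≤ b`).
[cite: ForbesSaptharishiShpilka2014, Cor. 26 (proof)] locator: paper:arxiv-1309.5668 p0016.txt:L12–L14 -/
theorem prod_pow_mul_shiftWt (v : ι → K) (a b : ι →₀ ℕ) :
    (∏ i, v i ^ (a i)) * shiftWt v a b = (mchoose b a : K) * ∏ i, v i ^ (b i) := by
  by_cases hab : a ≤ b
  · rw [shiftWt_eq, mul_left_comm, ← prod_mul_distrib]
    congr 2
    funext i
    rw [← pow_add, Nat.add_sub_cancel' (hab i)]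
  · rw [shiftWt_eq, mchoose_eq_zero_of_not_le hab, Nat.cast_zero, zero_mul, zero_mul, mul_zero]

end Shift

end FSS2014

end Literature.Computability.AlgebraicComplexity
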